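/-
Copyright (c) 2026 the pub-hodgecm-mathlib formalisation cell (harness21).  Prover seat hodgecm-mathlib-R90-C133-p02 (g0), Track B ∕ R90-TF, h413 = `stmt-HodgeConjecture-24833`,
R90-TF section S8 «ContSpec-n½» (R0 claim 2026-09-04T22:41Z after K2E1-p15's MODEL-FAMILY ledger: «`hLnP` = BLK-ISO ∘ (Iso ≤ V_P)» — this file is the second factor): the
`(K′, ω)`-ISOTYPIC VECTORS ARE FIXED BY THE BLOCK PROJECTOR `P = P_χ ∘ π_f(e)` whenever `K′` contains the projector's generators with the matching values of `ω`.
-/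
import Summits.HodgeConjecture.HodgeConjecture.Theorems.K2E1BlockProjectorRangeU            -- ★ (K2E4-p23∕K2E2-p12): `cm_blockProjector_eq_self_iff` (`P x = x ↔ U₀-invariant ∧ χ⁻¹-eigen under κ(K)`)
import Literature.NumberTheory.Automorphic.UnitaryGroupAutomorphicRep                         -- ★ Mok's `quasiSplit L⁺ L c N`
import HarnessLib

/-!
# S8 #4′ road — `R90S8IsoLeBlockProjectorFixedU2`: `Iso(K′, ω) ≤ V_P` — the `(K′, ω)`-isotypic vectors of a unitary representation of `U(H)(𝔸_{L⁺})` are fixed by the block projector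
# `P = P_χ ∘L π_f(e)` when `K′ ∋ ι_f(U₀), ι_∞(κ(K))` and `ω(ι_f k) = 1`, `ω(ι_∞ κ k) = χ(k⁻¹)` (the input «`Iso ≤ eqLocus P id`» of `hLnP` ∕ `hScP` in the (N_blk) chain)

Track B ∕ R90-TF, crux h413 = `stmt-HodgeConjecture-24833`, route of record `HCCMUnconditional`; cell `hodgecm-mathlib`, R90-TF section S8 «ContSpec-n½», socket #4′
`sock_S8_resH_spannedByCharLines`.  THEOREMS ONLY (no `def`, no `instance`, no `notation`, no named-fact hypothesis, no `sorry`; default heartbeats); lane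
`--supports stmt-HodgeConjecture-24833 --as helper` (count-neutral).  CLOSES NO SOCKET: it discharges the visible letter `hScP : resHBlock ≤ eqLocus P id` of ★ p862504
`resH_isotypic_le_orthogonal_lines` (with ★ BLK-ISO `resHBlock_le_iInf_eigenspace`, K2E1-p15) down to the INDEX-FAMILY data: that `K′ = Kad(Kf)` contains `ι_f(Kf)` and `ι_∞(κ(K))`
and that `ω` takes the values `1` resp. `χ(k⁻¹)` there (★ `K2E1KTypeCharacterArchLevelU` ∕ ★ p862475 `sideConditions_kad` at the Σ-family — H7's business).
THE MATHEMATICS ([Knapp1986, VIII §3]; [BorelJacquet1979, §4.1]).  ★ `cm_blockProjector_eq_self_iff`: `P x = x ⟺ (∀ k ∈ U₀, π(ι_f k) x = x) ∧ (∀ k, π(ι_∞ κ k) x = χ(k⁻¹)·x)`.  A vector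
in `Iso(K′, ω) = ⨅_{k ∈ K′} eigenspace (π k) (ω k)` satisfies `π k x = ω(k)·x` for all `k ∈ K′`; at `k = ι_f k₀` this is `x` (`ω = 1` there), at `k = ι_∞ κ k₀` it is `χ(k₀⁻¹)·x` — so `P x = x`.
* §1 **`iInf_eigenspace_le_eqLocus_blockProjector`** — every `N`, every `H`, any unitary strongly continuous `π` on a Hilbert space.
* §2 **`iso_le_eqLocus_blockProjector_quasiSplit`** — the print at Mok's `U(J₂) = quasiSplit L⁺ L c 2`, `π := R` on `L²(μ)`, in the `Iso` bytes of ★ p862113 ∕ p862504.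
HONEST LABEL: HC_CM is proved only modulo the 7 printed citations (2 remaining named inputs: hLiu418 = `stmt-HodgeConjecture-24832`, h413 = `stmt-HodgeConjecture-24833`) until
rung 0 closes; REL ≠ ★ ≠ BUILT; this file asserts no named fact and closes no socket; count-neutral.

## References
* [Knapp1986] A. W. Knapp, *Representation Theory of Semisimple Groups* (1986), VIII §3.
* [BorelJacquet1979] A. Borel, H. Jacquet, *Automorphic forms and automorphic representations*, PSPM 33.1 (1979), §4.1.
-/

set_option autoImplicit false
set_option linter.dupNamespace false  -- the mandated namespace `…HodgeConjecture.HodgeConjecture.R90.S8` (LEAD #1 L1) repeats the summit's segment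

noncomputable section

open MeasureTheory Filter Topology CompactlySupported NumberField ContRepresentation Set
open scoped InnerProductSpace ENNReal ComplexConjugate
open Literature.NumberTheory.Automorphic Literature.NumberTheory.Automorphic.UnitaryGroup AdelicGroupData
open Summit.HodgeConjecture.HodgeConjecture.Cruxes.H413.K2E1BlockProjectorRangeU (cm_blockProjector_eq_self_iff)

namespace Summit.HodgeConjecture.HodgeConjecture.R90.S8

/-! ## §1 Every `N`, every `H`: isotypic vectors are fixed by the block projector -/

section Generic

variable {L : Type} [Field L] [NumberField L] [IsCMField L] {N : ℕ} {H : Matrix (Fin N) (Fin N) L}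
  {K V : Type*} [Group K] [TopologicalSpace K] [MeasurableSpace K] [BorelSpace K]
  [NormedAddCommGroup V] [InnerProductSpace ℂ V] [CompleteSpace V]
  (π : ContRepresentation ℂ (cmDatum L N H).Adelic V) (hu : π.IsUnitary) (hc : π.IsStronglyContinuous)
  [MeasurableSpace (finAdelic (↥(maximalRealSubfield L)) L (IsCMField.complexConj L) N H)] [BorelSpace (finAdelic (↥(maximalRealSubfield L)) L (IsCMField.complexConj L) N H)]
  (νf : Measure (finAdelic (↥(maximalRealSubfield L)) L (IsCMField.complexConj L) N H)) [IsFiniteMeasureOnCompacts νf] [νf.IsMulLeftInvariant]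
  (κ : K →* UnitaryGroup.arch (↥(maximalRealSubfield L)) L (IsCMField.complexConj L) N H) (hκ : Continuous κ)
  (μK : Measure K) [IsFiniteMeasureOnCompacts μK] [IsProbabilityMeasure μK] [MeasurableMul K] [μK.IsMulLeftInvariant]
  (χ : C_c(K, ℂ)) (e : C_c(finAdelic (↥(maximalRealSubfield L)) L (IsCMField.complexConj L) N H, ℂ))

/-- **`Iso(K′, ω) ≤ V_P`** — every `N`, every `H`, any unitary strongly continuous `π` of `U(H)(𝔸_{L⁺})` on a Hilbert space `V`: if the level datum `(K′, ω)` contains the block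
projector's generators — `ι_f(U₀) ⊆ K′` with `ω = 1` there, `ι_∞(κ(K)) ⊆ K′` with `ω(ι_∞ κ k) = χ(k⁻¹)` — then every vector of `⨅_{k ∈ K′} eigenspace (π k) (ω k)` is fixed by
`P = P_χ ∘L π_f(e)` (★ `cm_blockProjector_eq_self_iff`, `.mpr`). [cite: Knapp1986, VIII §3] [cite: BorelJacquet1979, §4.1] -/
theorem iInf_eigenspace_le_eqLocus_blockProjector
    (hχmul : ∀ k l, χ (k * l) = χ k * χ l) (hχone : χ 1 = 1)
    (U₀ : Subgroup (finAdelic (↥(maximalRealSubfield L)) L (IsCMField.complexConj L) N H)) (he0 : ∀ g, g ∉ U₀ → e g = 0) (he1 : ∫ g, e g ∂νf = 1)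
    (heK : ∀ k ∈ U₀, ∀ x, e (k * x) = e x)
    (P : V →L[ℂ] V) (hPdef : P = ((π.restrict ((archToAdelic (↥(maximalRealSubfield L)) L (IsCMField.complexConj L) N H).comp κ)).integratedOperator (hu.restrict _)
          (hc.restrict _ ((continuous_archToAdelic (↥(maximalRealSubfield L)) L (IsCMField.complexConj L) N H).comp hκ)) μK χ ∘L
        (π.restrict (finAdelicToAdelic (↥(maximalRealSubfield L)) L (IsCMField.complexConj L) N H)).integratedOperator (hu.restrict _)
          (hc.restrict _ (continuous_finAdelicToAdelic (↥(maximalRealSubfield L)) L (IsCMField.complexConj L) N H)) νf e))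
    (K' : Subgroup (cmDatum L N H).Adelic) (ω : ↥K' →* ℂ)
    (hKf : ∀ k ∈ U₀, finAdelicToAdelic (↥(maximalRealSubfield L)) L (IsCMField.complexConj L) N H k ∈ K')
    (hKκ : ∀ k : K, archToAdelic (↥(maximalRealSubfield L)) L (IsCMField.complexConj L) N H (κ k) ∈ K')
    (hωf : ∀ (k : finAdelic (↥(maximalRealSubfield L)) L (IsCMField.complexConj L) N H) (hk : k ∈ U₀), ω ⟨_, hKf k hk⟩ = 1)
    (hωκ : ∀ k : K, ω ⟨_, hKκ k⟩ = χ k⁻¹) :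
    (⨅ k : ↥K', Module.End.eigenspace (((π (K'.subtype k) : V →L[ℂ] V)) : V →ₗ[ℂ] V) (ω k)) ≤ LinearMap.eqLocus (P : V →ₗ[ℂ] V) LinearMap.id := by
  intro x hx
  rw [Submodule.mem_iInf] at hx
  have hk' : ∀ k : ↥K', π (k : (cmDatum L N H).Adelic) x = ω k • x := fun k => by
    have h := hx k
    rw [Module.End.mem_eigenspace_iff] at h
    exact h
  rw [LinearMap.mem_eqLocus, LinearMap.id_apply, ContinuousLinearMap.coe_coe]
  subst hPdef
  refine (cm_blockProjector_eq_self_iff π hu hc νf κ hκ μK χ e hχmul hχone U₀ he0 he1 heK x).2 ⟨fun k hk => ?_, fun k => ?_⟩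
  · have h := hk' ⟨_, hKf k hk⟩
    rwa [hωf k hk, one_smul] at h
  · have h := hk' ⟨_, hKκ k⟩
    rwa [hωκ k] at h

end Generic

/-! ## §2 The print at Mok's `U(J₂) = quasiSplit L⁺ L c 2`, `π := R` on `L²(μ)` -/

section Print

variable (L : Type) [Field L] [NumberField L] [IsCMField L]
  (μ : Measure (quasiSplit (↥(maximalRealSubfield L)) L (IsCMField.complexConj L) 2).automorphicQuotient)
  [(quasiSplit (↥(maximalRealSubfield L)) L (IsCMField.complexConj L) 2).IsAutomorphicMeasure μ]
  {K : Type*} [Group K] [TopologicalSpace K] [MeasurableSpace K] [BorelSpace K]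
  [MeasurableSpace (finAdelic (↥(maximalRealSubfield L)) L (IsCMField.complexConj L) 2 ((StdForm.antidiagonal 2).over L))] [BorelSpace (finAdelic (↥(maximalRealSubfield L)) L (IsCMField.complexConj L) 2 ((StdForm.antidiagonal 2).over L))]
  (νf : Measure (finAdelic (↥(maximalRealSubfield L)) L (IsCMField.complexConj L) 2 ((StdForm.antidiagonal 2).over L))) [IsFiniteMeasureOnCompacts νf] [νf.IsMulLeftInvariant]
  (κ : K →* UnitaryGroup.arch (↥(maximalRealSubfield L)) L (IsCMField.complexConj L) 2 ((StdForm.antidiagonal 2).over L)) (hκ : Continuous κ)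
  (μK : Measure K) [IsFiniteMeasureOnCompacts μK] [IsProbabilityMeasure μK] [MeasurableMul K] [μK.IsMulLeftInvariant]
  (χ : C_c(K, ℂ)) (e : C_c(finAdelic (↥(maximalRealSubfield L)) L (IsCMField.complexConj L) 2 ((StdForm.antidiagonal 2).over L), ℂ))

/-- **`Iso(K′, ω) ≤ V_P` AT `U(J₂)`, `π := R` on `L²(μ)`** — in the `Iso` bytes of ★ p862113 ∕ p862504 (`⨅ k : ↥K', eigenspace (R (K'.subtype k)) (ω k)`): under the generator
memberships and values (`hKf hKκ hωf hωκ`), `Iso(K′, ω) ≤ eqLocus P id`.  With ★ BLK-ISO `resHBlock_le_iInf_eigenspace` this discharges `hScP` of ★ `resH_isotypic_le_orthogonal_lines`.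
[cite: Knapp1986, VIII §3] [cite: BorelJacquet1979, §4.1] -/
theorem iso_le_eqLocus_blockProjector_quasiSplit
    (hχmul : ∀ k l, χ (k * l) = χ k * χ l) (hχone : χ 1 = 1)
    (U₀ : Subgroup (finAdelic (↥(maximalRealSubfield L)) L (IsCMField.complexConj L) 2 ((StdForm.antidiagonal 2).over L))) (he0 : ∀ g, g ∉ U₀ → e g = 0) (he1 : ∫ g, e g ∂νf = 1)
    (heK : ∀ k ∈ U₀, ∀ x, e (k * x) = e x)
    (P : (quasiSplit (↥(maximalRealSubfield L)) L (IsCMField.complexConj L) 2).L2 μ →L[ℂ] (quasiSplit (↥(maximalRealSubfield L)) L (IsCMField.complexConj L) 2).L2 μ)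
    (hPdef : P = ((((quasiSplit (↥(maximalRealSubfield L)) L (IsCMField.complexConj L) 2).rightRegular μ).restrict ((archToAdelic (↥(maximalRealSubfield L)) L (IsCMField.complexConj L) 2 ((StdForm.antidiagonal 2).over L)).comp κ)).integratedOperator (((quasiSplit (↥(maximalRealSubfield L)) L (IsCMField.complexConj L) 2).isUnitary_rightRegular μ).restrict _)
          (((quasiSplit (↥(maximalRealSubfield L)) L (IsCMField.complexConj L) 2).isStronglyContinuous_rightRegular_holds μ).restrict _ ((continuous_archToAdelic (↥(maximalRealSubfield L)) L (IsCMField.complexConj L) 2 ((StdForm.antidiagonal 2).over L)).comp hκ)) μK χ ∘L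
        (((quasiSplit (↥(maximalRealSubfield L)) L (IsCMField.complexConj L) 2).rightRegular μ).restrict (finAdelicToAdelic (↥(maximalRealSubfield L)) L (IsCMField.complexConj L) 2 ((StdForm.antidiagonal 2).over L))).integratedOperator (((quasiSplit (↥(maximalRealSubfield L)) L (IsCMField.complexConj L) 2).isUnitary_rightRegular μ).restrict _) (((quasiSplit (↥(maximalRealSubfield L)) L (IsCMField.complexConj L) 2).isStronglyContinuous_rightRegular_holds μ).restrict _ (continuous_finAdelicToAdelic (↥(maximalRealSubfield L)) L (IsCMField.complexConj L) 2 ((StdForm.antidiagonal 2).over L))) νf e))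
    (K' : Subgroup (quasiSplit (↥(maximalRealSubfield L)) L (IsCMField.complexConj L) 2).Adelic) (ω : ↥K' →* ℂ)
    (hKf : ∀ k ∈ U₀, finAdelicToAdelic (↥(maximalRealSubfield L)) L (IsCMField.complexConj L) 2 ((StdForm.antidiagonal 2).over L) k ∈ K')
    (hKκ : ∀ k : K, archToAdelic (↥(maximalRealSubfield L)) L (IsCMField.complexConj L) 2 ((StdForm.antidiagonal 2).over L) (κ k) ∈ K')
    (hωf : ∀ (k : finAdelic (↥(maximalRealSubfield L)) L (IsCMField.complexConj L) 2 ((StdForm.antidiagonal 2).over L)) (hk : k ∈ U₀), ω ⟨_, hKf k hk⟩ = 1)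
    (hωκ : ∀ k : K, ω ⟨_, hKκ k⟩ = χ k⁻¹) :
    (⨅ k : ↥K', Module.End.eigenspace ((((quasiSplit (↥(maximalRealSubfield L)) L (IsCMField.complexConj L) 2).rightRegular μ) (K'.subtype k) : (quasiSplit (↥(maximalRealSubfield L)) L (IsCMField.complexConj L) 2).L2 μ →L[ℂ] (quasiSplit (↥(maximalRealSubfield L)) L (IsCMField.complexConj L) 2).L2 μ) :
        (quasiSplit (↥(maximalRealSubfield L)) L (IsCMField.complexConj L) 2).L2 μ →ₗ[ℂ] (quasiSplit (↥(maximalRealSubfield L)) L (IsCMField.complexConj L) 2).L2 μ) (ω k)) ≤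
      LinearMap.eqLocus (P : (quasiSplit (↥(maximalRealSubfield L)) L (IsCMField.complexConj L) 2).L2 μ →ₗ[ℂ] (quasiSplit (↥(maximalRealSubfield L)) L (IsCMField.complexConj L) 2).L2 μ) LinearMap.id :=
  iInf_eigenspace_le_eqLocus_blockProjector (H := (StdForm.antidiagonal 2).over L) ((quasiSplit (↥(maximalRealSubfield L)) L (IsCMField.complexConj L) 2).rightRegular μ)
    ((quasiSplit (↥(maximalRealSubfield L)) L (IsCMField.complexConj L) 2).isUnitary_rightRegular μ)
    ((quasiSplit (↥(maximalRealSubfield L)) L (IsCMField.complexConj L) 2).isStronglyContinuous_rightRegular_holds μ) νf κ hκ μK χ e hχmul hχone U₀ he0 he1 heK P hPdef K' ω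
    hKf hKκ hωf hωκ

end Print

end Summit.HodgeConjecture.HodgeConjecture.R90.S8

end
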